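import Literature.NumberTheory.Automorphic.MirabolicEisensteinConvergence
import Literature.NumberTheory.GaloisRepresentations.HeckeCharacterNormCharacter
import HarnessLib

/-!
# The mirabolic Eisenstein series of `GL_n` twisted by a Hecke character, `E(g, Φ; s, η)`, in the
# half-plane of absolute convergence

Topic `NumberTheory/Automorphic`; namespace `Literature.NumberTheory.Automorphic`. The sibling of
`MirabolicEisensteinSeries` (trivial character) for a general idele class character `η` — J. W.
Cogdell, *Analytic theory of `L`-functions for `GL_n`*, in *An Introduction to the Langlands
Program* (2003), §2.3, p. 210: for `Φ ∈ 𝒮(𝔸ⁿ)` and a unitary idele class character `η`,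

  `F(g, Φ; s, η) = |det g|^s ∫_{𝔸ˣ} Φ(a e_n g) |a|^{ns} η(a) d^×a`,
  `E(g, Φ; s, η) = ∑_{γ ∈ P'_n(k) \ GL_n(k)} F(γ g, Φ; s, η)`

("absolutely convergent for `Re(s) > 1`", loc. cit., after Jacquet–Shalika, Amer. J. Math. 103
(1981), §4). In the Rankin–Selberg integral `I(s; φ, φ', Φ) = ∫ φ(g) φ'(g) E(g, Φ; s, η) dg` for a
pair of cusp forms `φ ∈ π`, `φ' ∈ π'` on `GL_n` one takes `η = ω_π ω_{π'}` (loc. cit. p. 211), the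
series transforming under the centre by `η⁻¹`; the tree's `mirabolicEisenstein` is the case `η = 1`
(pairs with `ω_π ω_{π'} = 1`, e.g. `(π, π̄)`), and the named fact
`MoeglinWaldspurger1989_partialPairL_entire_of_ne_conj` (Mœglin–Waldspurger (1989), Cor. (i)(b)) for
the pairs with `ω_π ω_{π'} ≠ 1` needs the twisted series (hypothesis `htw` of
`MoeglinWaldspurger1989_partialPairL_entire_of_ne_conj_of_local`,
`PairLFunctionMeromorphicContinuationNeConjLocalReduction`). This file is the first layer of that
twisted theory: the object, its formal properties, and its absolute convergence for `re s > 1`.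

## Contents

* `eisensteinKernelTwisted K η Φ s x a = Φ(a x) |a|^{ns} η(a)` (**definition**; the untwisted
  `eisensteinKernel` times `η(a)`), `tateVectorIntegralTwisted K ν η Φ s x = ∫_{𝔸_Kˣ} Φ(a x) |a|^{ns} η(a) dν(a)`
  and the **twisted mirabolic Eisenstein series** (**definition**)
  `mirabolicEisensteinTwisted K ν η Φ s g = |det g|^s ∑_{ξ ∈ ℙ^{n-1}(K)} ∫_{𝔸_Kˣ} Φ(a ξ g) |a|^{ns} η(a) dν(a)`
  — Cogdell's `E(g, Φ; s, η)` via `P'_n(k) \ GL_n(k) ≅ ℙ^{n-1}(k)`, `γ ↦ k e_n γ`, exactly as in the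
  untwisted file (the summand does not depend on the representative of the line because `η` is
  trivial on `Kˣ`, `tateVectorIntegralTwisted_ratVec_smul`);
* `…_one`: for `η = 1` the three objects are the untwisted ones of `MirabolicEisensteinSeries`;
* **proved formal properties** (all `s`, all right-invariant `ν`): representative independence;
  `tateVectorIntegralTwisted_units_smul_eq` (rescaling by an idele `a` multiplies by `|a|^{-ns} η(a)⁻¹`);
  **automorphy** `E(γ g; η) = E(g; η)` for `γ ∈ GL_n(K)` (`mirabolicEisensteinTwisted_rational_mul`);
  **central character `η⁻¹`**: `E(a g; η) = η(a)⁻¹ E(g; η)` for scalar ideles `a`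
  (`mirabolicEisensteinTwisted_scalar_mul`; Cogdell, p. 211: "under the center the Eisenstein series
  transforms by the central character `η⁻¹`"); hence, **for `η` trivial on `A_G = ℝ_{>0}`**,
  invariance under the tree's `A_G GL_n(K)` (`mirabolicEisensteinTwisted_mul_of_mem_quotientSubgroup`)
  and the descent `mirabolicEisensteinTwistedQuot` to the automorphic quotient of `AdelicGroupData.gl n K`;
* **absolute convergence for `re s > 1` and unitary `η`**
  (`integrable_and_summable_mirabolicEisensteinTwisted`): since `|η(a)| = 1`, the majorants are
  those of the untwisted series, and the theorem `summable_mirabolicEisenstein_holds`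
  (`MirabolicEisensteinConvergence`) applies verbatim; `summable_tateVectorIntegralTwisted`.

What is NOT here (next layers): the analytic continuation of `E(g, Φ; s, η)` — ENTIRE for unitary
`η ≠ 1` trivial on `A_G`, the boundary terms of Tate's splitting being `Φ(0) ∫_{C_K¹} η = 0`,
`Φ̂(0) ∫_{C_K¹} η⁻¹ = 0` (`HeckeCharacter.integral_normOne_eq_zero_of_not_isNormTwist`) —, its
moderate growth, and the twisted Rankin–Selberg integrals.

## References

* J. W. Cogdell, *Analytic theory of `L`-functions for `GL_n`*, in J. Bernstein, S. Gelbart (eds.),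
  *An Introduction to the Langlands Program*, Birkhäuser (2003), §2.3, pp. 209–212
  [CogdellAnalyticTheory2004].
* H. Jacquet, J. A. Shalika, *On Euler products and the classification of automorphic
  representations I*, Amer. J. Math. 103 (1981), §4 [JacquetShalikaAJM1981].
-/

noncomputable section

open scoped NNReal
open NumberField IsDedekindDomain MeasureTheory NumberField.mixedEmbedding Matrix
open Literature.NumberTheory.GaloisRepresentations (HeckeCharacter ideleGroup principalIdeles)

namespace Literature.NumberTheory.Automorphic

/-! ### The twisted kernel -/

section Algebra

variable (K : Type) [Field K] [NumberField K] {n : ℕ}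

/-- The twisted kernel `a ↦ Φ(a x) |a|^{ns} η(a)` on the idele group (`eisensteinKernel` times the
value of the Hecke character `η`; Cogdell (2003), §2.3, p. 210, the integrand of `F(g, Φ; s, η)`).
[cite: CogdellAnalyticTheory2004, §2.3] -/
def eisensteinKernelTwisted (η : HeckeCharacter K) (Φ : (Fin n → AdeleRing (𝓞 K) K) → ℂ) (s : ℂ)
    (x : Fin n → AdeleRing (𝓞 K) K) (a : ideleGroup K) : ℂ :=
  eisensteinKernel K Φ s x a * ((η a : ℂˣ) : ℂ)

variable {K}

/-- Unfolding the twisted kernel. [folklore] -/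
theorem eisensteinKernelTwisted_apply (η : HeckeCharacter K) (Φ : (Fin n → AdeleRing (𝓞 K) K) → ℂ)
    (s : ℂ) (x : Fin n → AdeleRing (𝓞 K) K) (a : ideleGroup K) :
    eisensteinKernelTwisted K η Φ s x a = eisensteinKernel K Φ s x a * ((η a : ℂˣ) : ℂ) := rfl

/-- For the trivial character the twisted kernel is the untwisted one. [folklore] -/
@[simp]
theorem eisensteinKernelTwisted_one (Φ : (Fin n → AdeleRing (𝓞 K) K) → ℂ) (s : ℂ)
    (x : Fin n → AdeleRing (𝓞 K) K) (a : ideleGroup K) :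
    eisensteinKernelTwisted K 1 Φ s x a = eisensteinKernel K Φ s x a := by
  rw [eisensteinKernelTwisted_apply, GaloisRepresentations.HeckeCharacter.one_apply, Units.val_one, mul_one]

/-- `η = 1` as functions. [folklore] -/
theorem eisensteinKernelTwisted_one_eq (Φ : (Fin n → AdeleRing (𝓞 K) K) → ℂ) (s : ℂ)
    (x : Fin n → AdeleRing (𝓞 K) K) :
    eisensteinKernelTwisted K 1 Φ s x = eisensteinKernel K Φ s x :=
  funext fun a => eisensteinKernelTwisted_one Φ s x a

/-- **The twist does not change absolute values** for a unitary `η`: `|Φ(a x) |a|^{ns} η(a)| =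
|Φ(a x) |a|^{ns}|`. [folklore] -/
theorem norm_eisensteinKernelTwisted {η : HeckeCharacter K} (hη : η.IsUnitary)
    (Φ : (Fin n → AdeleRing (𝓞 K) K) → ℂ) (s : ℂ) (x : Fin n → AdeleRing (𝓞 K) K) (a : ideleGroup K) :
    ‖eisensteinKernelTwisted K η Φ s x a‖ = ‖eisensteinKernel K Φ s x a‖ := by
  rw [eisensteinKernelTwisted_apply, norm_mul, hη a, mul_one]

/-- `Φ((a u) x) |a u|^{ns} η(a u) = Φ(a (u x)) |a|^{ns} η(a)` for a principal idele `u` (`|u| = 1`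
and `η(u) = 1`, `HeckeCharacter.map_principal`). [folklore] -/
theorem eisensteinKernelTwisted_mul_of_mem_principalIdeles (η : HeckeCharacter K)
    (Φ : (Fin n → AdeleRing (𝓞 K) K) → ℂ) (s : ℂ) (x : Fin n → AdeleRing (𝓞 K) K) (a : ideleGroup K)
    {u : ideleGroup K} (hu : u ∈ principalIdeles K) :
    eisensteinKernelTwisted K η Φ s x (a * u) = eisensteinKernelTwisted K η Φ s ((u : AdeleRing (𝓞 K) K) • x) a := by
  rw [eisensteinKernelTwisted_apply, eisensteinKernelTwisted_apply,
    eisensteinKernel_mul_of_mem_principalIdeles Φ s x a hu, map_mul, η.map_principal hu, mul_one]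

/-- `Φ(a' (a x)) |a'|^{ns} η(a') = |a|^{-ns} η(a)⁻¹ · Φ((a' a) x) |a' a|^{ns} η(a' a)`. [folklore] -/
theorem eisensteinKernelTwisted_units_smul (η : HeckeCharacter K) (Φ : (Fin n → AdeleRing (𝓞 K) K) → ℂ)
    (s : ℂ) (x : Fin n → AdeleRing (𝓞 K) K) (a a' : ideleGroup K) :
    eisensteinKernelTwisted K η Φ s ((a : AdeleRing (𝓞 K) K) • x) a' =
      (((IdeleClassGroup.ideleNorm K a : ℝ) : ℂ) ^ ((n : ℂ) * s))⁻¹ * ((η a : ℂˣ) : ℂ)⁻¹ *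
        eisensteinKernelTwisted K η Φ s x (a' * a) := by
  rw [eisensteinKernelTwisted_apply, eisensteinKernelTwisted_apply, eisensteinKernel_units_smul Φ s x a a',
    map_mul, Units.val_mul]
  have hη : ((η a : ℂˣ) : ℂ) ≠ 0 := (η a).ne_zero
  field_simp

end Algebra

/-! ### The twisted Tate-type integrals and the twisted Eisenstein series -/

section Eisenstein

variable (K : Type) [Field K] [NumberField K] {n : ℕ}
variable [MeasurableSpace (AdeleRing (𝓞 K) K)]

/-- The **twisted Tate-type integral** `∫_{𝔸_Kˣ} Φ(a x) |a|^{ns} η(a) dν(a)` attached to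
`Φ : 𝔸_Kⁿ → ℂ`, a vector `x ∈ 𝔸_Kⁿ` and a Hecke character `η` (for `x = e_n g` this is
`|det g|^{-s} F(g, Φ; s, η)` of Cogdell (2003), §2.3, p. 210). [cite: CogdellAnalyticTheory2004, §2.3] -/
def tateVectorIntegralTwisted (ν : Measure (ideleGroup K)) (η : HeckeCharacter K)
    (Φ : (Fin n → AdeleRing (𝓞 K) K) → ℂ) (s : ℂ) (x : Fin n → AdeleRing (𝓞 K) K) : ℂ :=
  ∫ a, eisensteinKernelTwisted K η Φ s x a ∂ν

/-- The **mirabolic Eisenstein series twisted by `η`** in its half-plane of absolute convergence: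
`E(g, Φ; s, η) = |det g|^s ∑_{ξ ∈ ℙ^{n-1}(K)} ∫_{𝔸_Kˣ} Φ(a ξ g) |a|^{ns} η(a) dν(a)` — Cogdell's
`E(g, Φ; s, η) = ∑_{γ ∈ P'_n(k) \ GL_n(k)} F(γ g, Φ; s, η)`, `F(g, Φ; s, η) = |det g|^s ∫_{𝔸ˣ}
Φ(a e_n g) |a|^{ns} η(a) d^×a` (op. cit. §2.3, p. 210), via `P'_n(k) \ GL_n(k) ≅ ℙ^{n-1}(k)`,
`γ ↦ k e_n γ`, and `|det γ| = 1` (the summand does not depend on the representative of the line,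
`tateVectorIntegralTwisted_ratVec_smul`). A `tsum` (junk `0` off the region of convergence; genuine for
`re s > 1` and unitary `η`, `integrable_and_summable_mirabolicEisensteinTwisted`). For `η = 1` this is
`mirabolicEisenstein` (`mirabolicEisensteinTwisted_one`). [cite: CogdellAnalyticTheory2004, §2.3] -/
def mirabolicEisensteinTwisted (ν : Measure (ideleGroup K)) (η : HeckeCharacter K)
    (Φ : (Fin n → AdeleRing (𝓞 K) K) → ℂ) (s : ℂ) (g : GL (Fin n) (AdeleRing (𝓞 K) K)) : ℂ :=
  ((IdeleClassGroup.ideleNorm K (Matrix.GeneralLinearGroup.det g) : ℝ) : ℂ) ^ s *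
    ∑' p : Projectivization K (Fin n → K),
      tateVectorIntegralTwisted K ν η Φ s (ratVec K p.rep ᵥ* (g : Matrix (Fin n) (Fin n) (AdeleRing (𝓞 K) K)))

variable {K}

/-- `η = 1`: the twisted Tate-type integral is the untwisted one. [folklore] -/
@[simp]
theorem tateVectorIntegralTwisted_one (ν : Measure (ideleGroup K)) (Φ : (Fin n → AdeleRing (𝓞 K) K) → ℂ)
    (s : ℂ) (x : Fin n → AdeleRing (𝓞 K) K) :
    tateVectorIntegralTwisted K ν 1 Φ s x = tateVectorIntegral K ν Φ s x := by
  unfold tateVectorIntegralTwisted tateVectorIntegral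
  rw [eisensteinKernelTwisted_one_eq]

/-- `η = 1`: the twisted Eisenstein series is the mirabolic Eisenstein series of
`MirabolicEisensteinSeries`. [folklore] -/
@[simp]
theorem mirabolicEisensteinTwisted_one (ν : Measure (ideleGroup K)) (Φ : (Fin n → AdeleRing (𝓞 K) K) → ℂ)
    (s : ℂ) (g : GL (Fin n) (AdeleRing (𝓞 K) K)) :
    mirabolicEisensteinTwisted K ν 1 Φ s g = mirabolicEisenstein K ν Φ s g := by
  unfold mirabolicEisensteinTwisted mirabolicEisenstein
  simp_rw [tateVectorIntegralTwisted_one]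

/-! ### Substitutions in the Haar integral -/

variable [BorelSpace (AdeleRing (𝓞 K) K)]

/-- **Independence of the representative.** For `u ∈ Kˣ ⊆ 𝔸_Kˣ`:
`∫ Φ(a u x) |a|^{ns} η(a) dν(a) = ∫ Φ(a x) |a|^{ns} η(a) dν(a)` (substitute `a ↦ a u⁻¹`; `|u| = 1`,
`η(u) = 1`). [folklore] -/
theorem tateVectorIntegralTwisted_units_smul (ν : Measure (ideleGroup K)) [ν.IsMulRightInvariant]
    (η : HeckeCharacter K) (Φ : (Fin n → AdeleRing (𝓞 K) K) → ℂ) (s : ℂ) (x : Fin n → AdeleRing (𝓞 K) K)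
    {u : ideleGroup K} (hu : u ∈ principalIdeles K) :
    tateVectorIntegralTwisted K ν η Φ s ((u : AdeleRing (𝓞 K) K) • x) = tateVectorIntegralTwisted K ν η Φ s x := by
  unfold tateVectorIntegralTwisted
  calc ∫ a, eisensteinKernelTwisted K η Φ s ((u : AdeleRing (𝓞 K) K) • x) a ∂ν
      = ∫ a, eisensteinKernelTwisted K η Φ s x (a * u) ∂ν := by
        simp_rw [eisensteinKernelTwisted_mul_of_mem_principalIdeles η Φ s x _ hu]
    _ = ∫ a, eisensteinKernelTwisted K η Φ s x a ∂ν := integral_mul_right_eq_self _ u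

/-- The summand of the twisted Eisenstein series at `c ξ`, `c ∈ Kˣ`, equals the summand at `ξ`
(Cogdell (2003), §2.3: the sum is over `P'_n(k) \ GL_n(k) ≅ ℙ^{n-1}(k)`). [folklore] -/
theorem tateVectorIntegralTwisted_ratVec_smul (ν : Measure (ideleGroup K)) [ν.IsMulRightInvariant]
    (η : HeckeCharacter K) (Φ : (Fin n → AdeleRing (𝓞 K) K) → ℂ) (s : ℂ) (c : Kˣ) (ξ : Fin n → K)
    (M : Matrix (Fin n) (Fin n) (AdeleRing (𝓞 K) K)) :
    tateVectorIntegralTwisted K ν η Φ s (ratVec K (c • ξ) ᵥ* M) =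
      tateVectorIntegralTwisted K ν η Φ s (ratVec K ξ ᵥ* M) := by
  have hu : Units.map (algebraMap K (AdeleRing (𝓞 K) K)).toMonoidHom c ∈ principalIdeles K := ⟨c, rfl⟩
  rw [Units.smul_def, ratVec_smul, Matrix.smul_vecMul,
    show (algebraMap K (AdeleRing (𝓞 K) K)) (c : K) =
      ((Units.map (algebraMap K (AdeleRing (𝓞 K) K)).toMonoidHom c : ideleGroup K) : AdeleRing (𝓞 K) K) from rfl,
    tateVectorIntegralTwisted_units_smul ν η Φ s _ hu]

/-- Rescaling the vector by an idele `a` multiplies the twisted Tate-type integral by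
`|a|^{-ns} η(a)⁻¹` (substitute `a' ↦ a' a⁻¹`). [folklore] -/
theorem tateVectorIntegralTwisted_units_smul_eq (ν : Measure (ideleGroup K)) [ν.IsMulRightInvariant]
    (η : HeckeCharacter K) (Φ : (Fin n → AdeleRing (𝓞 K) K) → ℂ) (s : ℂ) (x : Fin n → AdeleRing (𝓞 K) K)
    (a : ideleGroup K) :
    tateVectorIntegralTwisted K ν η Φ s ((a : AdeleRing (𝓞 K) K) • x) =
      (((IdeleClassGroup.ideleNorm K a : ℝ) : ℂ) ^ ((n : ℂ) * s))⁻¹ * ((η a : ℂˣ) : ℂ)⁻¹ *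
        tateVectorIntegralTwisted K ν η Φ s x := by
  unfold tateVectorIntegralTwisted
  simp_rw [eisensteinKernelTwisted_units_smul η Φ s x a]
  rw [integral_const_mul, integral_mul_right_eq_self (fun a' => eisensteinKernelTwisted K η Φ s x a') a]

/-! ### Automorphy and the central character -/

/-- **Automorphy of the twisted Eisenstein series**: `E(γ g, Φ; s, η) = E(g, Φ; s, η)` for
`γ ∈ GL_n(K)`, for every right-invariant `ν` and every `s` (`|det γ| = 1`, and `γ` permutes the
rational lines; Cogdell (2003), §2.3). [cite: CogdellAnalyticTheory2004, §2.3] -/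
theorem mirabolicEisensteinTwisted_rational_mul (ν : Measure (ideleGroup K)) [ν.IsMulRightInvariant]
    (η : HeckeCharacter K) (Φ : (Fin n → AdeleRing (𝓞 K) K) → ℂ) (s : ℂ) (γ : GL (Fin n) K)
    (g : GL (Fin n) (AdeleRing (𝓞 K) K)) :
    mirabolicEisensteinTwisted K ν η Φ s
        (Matrix.GeneralLinearGroup.map (algebraMap K (AdeleRing (𝓞 K) K)) γ * g) =
      mirabolicEisensteinTwisted K ν η Φ s g := by
  unfold mirabolicEisensteinTwisted
  congr 1
  · rw [map_mul, map_mul, ideleNorm_det_map_eq_one, one_mul]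
  · symm
    rw [← (projectivizationCongr γ).tsum_eq]
    refine tsum_congr fun p => ?_
    obtain ⟨c, hc⟩ := exists_rep_projectivizationCongr γ p
    rw [hc, tateVectorIntegralTwisted_ratVec_smul, ratVec_vecMul, Matrix.vecMul_vecMul,
      ← Matrix.GeneralLinearGroup.coe_mul]

/-- **Central character `η⁻¹`**: `E(a g, Φ; s, η) = η(a)⁻¹ E(g, Φ; s, η)` for a scalar idele `a`
(`|det (a g)|^s = |a|^{ns} |det g|^s` against `∫ Φ(a' ξ a g) |a'|^{ns} η(a') = |a|^{-ns} η(a)⁻¹ ∫ …`;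
Cogdell (2003), §2.3, p. 211: "under the center the Eisenstein series transforms by the central
character `η⁻¹`"). [cite: CogdellAnalyticTheory2004, §2.3] -/
theorem mirabolicEisensteinTwisted_scalar_mul (ν : Measure (ideleGroup K)) [ν.IsMulRightInvariant]
    (η : HeckeCharacter K) (Φ : (Fin n → AdeleRing (𝓞 K) K) → ℂ) (s : ℂ) (a : ideleGroup K)
    (g : GL (Fin n) (AdeleRing (𝓞 K) K)) :
    mirabolicEisensteinTwisted K ν η Φ s (Matrix.GeneralLinearGroup.scalar (Fin n) a * g) =
      ((η a : ℂˣ) : ℂ)⁻¹ * mirabolicEisensteinTwisted K ν η Φ s g := by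
  have ha := ideleNorm_cpow_ne_zero a ((n : ℂ) * s)
  have hη : ((η a : ℂˣ) : ℂ) ≠ 0 := (η a).ne_zero
  have hdet : ((IdeleClassGroup.ideleNorm K (Matrix.GeneralLinearGroup.det
      (Matrix.GeneralLinearGroup.scalar (Fin n) a * g)) : ℝ) : ℂ) ^ s =
      ((IdeleClassGroup.ideleNorm K a : ℝ) : ℂ) ^ ((n : ℂ) * s) *
        ((IdeleClassGroup.ideleNorm K (Matrix.GeneralLinearGroup.det g) : ℝ) : ℂ) ^ s := by
    rw [map_mul, Matrix.GeneralLinearGroup.det_scalar, Fintype.card_fin, map_mul, map_pow,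
      NNReal.coe_mul, Complex.ofReal_mul,
      Complex.mul_cpow_ofReal_nonneg (NNReal.coe_nonneg _) (NNReal.coe_nonneg _), NNReal.coe_pow,
      ofReal_pow_cpow (NNReal.coe_nonneg _)]
  unfold mirabolicEisensteinTwisted
  simp_rw [vecMul_scalar_mul, tateVectorIntegralTwisted_units_smul_eq, tsum_mul_left, hdet]
  field_simp

/-- **Invariance under `A_G GL_n(K)` for `η` trivial on `A_G`.** If `η(ρ(t)) = 1` for all `t > 0`
(`posRealIdele`; the characters of the tree's `L²(GL_1(K) A_G \ GL_1(𝔸_K))`, e.g. `ω_π ω_{π'}` for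
cuspidal `π, π'` in the `A_G`-trivial model), then `E(·, Φ; s, η)` is invariant under left
multiplication by `A_G · GL_n(K)` (`(AdelicGroupData.gl n K).quotientSubgroup`). [folklore] -/
theorem mirabolicEisensteinTwisted_mul_of_mem_quotientSubgroup (ν : Measure (ideleGroup K))
    [ν.IsMulRightInvariant] {η : HeckeCharacter K} (hη₀ : ∀ t : ℝ≥0ˣ, η (posRealIdele K t) = 1)
    (Φ : (Fin n → AdeleRing (𝓞 K) K) → ℂ) (s : ℂ)
    {h : GL (Fin n) (AdeleRing (𝓞 K) K)} (hh : h ∈ (AdelicGroupData.gl n K).quotientSubgroup)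
    (g : GL (Fin n) (AdeleRing (𝓞 K) K)) :
    mirabolicEisensteinTwisted K ν η Φ s (h * g) = mirabolicEisensteinTwisted K ν η Φ s g := by
  revert g
  change h ∈ (AdelicGroupData.gl n K).center' ⊔ (AdelicGroupData.gl n K).arithmeticSubgroup at hh
  rw [Subgroup.sup_eq_closure] at hh
  refine Subgroup.closure_induction (p := fun h _ => ∀ g : GL (Fin n) (AdeleRing (𝓞 K) K),
    mirabolicEisensteinTwisted K ν η Φ s (h * g) = mirabolicEisensteinTwisted K ν η Φ s g) ?_ ?_ ?_ ?_ hh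
  · rintro x (⟨t, rfl⟩ | ⟨γ, rfl⟩) g
    · have h1 := mirabolicEisensteinTwisted_scalar_mul ν η Φ s (posRealIdele K t) g
      rw [hη₀ t, Units.val_one, inv_one, one_mul] at h1
      exact h1
    · exact mirabolicEisensteinTwisted_rational_mul ν η Φ s γ g
  · intro g
    rw [one_mul]
  · intro x y _ _ hx hy g
    rw [mul_assoc, hx, hy]
  · intro x _ hx g
    rw [← hx (x⁻¹ * g), mul_inv_cancel_left]

/-- `E(a⁻¹; η) = E(b⁻¹; η)` when `a⁻¹ b ∈ A_G GL_n(K)` and `η` is trivial on `A_G` (the descent datum).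
[folklore] -/
theorem mirabolicEisensteinTwisted_inv_eq_of_inv_mul_mem (ν : Measure (ideleGroup K))
    [ν.IsMulRightInvariant] {η : HeckeCharacter K} (hη₀ : ∀ t : ℝ≥0ˣ, η (posRealIdele K t) = 1)
    (Φ : (Fin n → AdeleRing (𝓞 K) K) → ℂ) (s : ℂ)
    {a b : GL (Fin n) (AdeleRing (𝓞 K) K)} (h : a⁻¹ * b ∈ (AdelicGroupData.gl n K).quotientSubgroup) :
    mirabolicEisensteinTwisted K ν η Φ s a⁻¹ = mirabolicEisensteinTwisted K ν η Φ s b⁻¹ := by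
  have e : b⁻¹ = (a⁻¹ * b)⁻¹ * a⁻¹ := by group
  rw [e]
  exact (mirabolicEisensteinTwisted_mul_of_mem_quotientSubgroup ν hη₀ Φ s (inv_mem h) a⁻¹).symm

/-- **The twisted Eisenstein series on the automorphic quotient** (for `η` trivial on `A_G`): the
descent of `x ↦ E(x⁻¹, Φ; s, η)` to `GL_n(𝔸_K) ⧸ A_G GL_n(K)` (`AdelicGroupData.gl n K`), the tree's
dictionary between right-invariant functions on the left-coset space and classical left-invariant
automorphic functions (as `mirabolicEisensteinQuot`). [folklore] -/
def mirabolicEisensteinTwistedQuot (ν : Measure (ideleGroup K)) [ν.IsMulRightInvariant]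
    {η : HeckeCharacter K} (hη₀ : ∀ t : ℝ≥0ˣ, η (posRealIdele K t) = 1)
    (Φ : (Fin n → AdeleRing (𝓞 K) K) → ℂ) (s : ℂ) :
    (AdelicGroupData.gl n K).automorphicQuotient → ℂ :=
  Quotient.lift
    (fun x : (AdelicGroupData.gl n K).Adelic =>
      mirabolicEisensteinTwisted K ν η Φ s (x⁻¹ : GL (Fin n) (AdeleRing (𝓞 K) K)))
    fun _ _ hab => mirabolicEisensteinTwisted_inv_eq_of_inv_mul_mem ν hη₀ Φ s (QuotientGroup.leftRel_apply.mp hab)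

/-- The descended twisted Eisenstein series at the coset of `x` is `E(x⁻¹, Φ; s, η)` (definitional).
[folklore] -/
theorem mirabolicEisensteinTwistedQuot_toAutomorphicQuotient (ν : Measure (ideleGroup K))
    [ν.IsMulRightInvariant] {η : HeckeCharacter K} (hη₀ : ∀ t : ℝ≥0ˣ, η (posRealIdele K t) = 1)
    (Φ : (Fin n → AdeleRing (𝓞 K) K) → ℂ) (s : ℂ) (x : (AdelicGroupData.gl n K).Adelic) :
    mirabolicEisensteinTwistedQuot ν hη₀ Φ s ((AdelicGroupData.gl n K).toAutomorphicQuotient x) =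
      mirabolicEisensteinTwisted K ν η Φ s (x⁻¹ : GL (Fin n) (AdeleRing (𝓞 K) K)) := rfl

/-! ### Absolute convergence for `re s > 1` (unitary `η`) -/

/-- **Absolute convergence of the twisted Eisenstein series for `re s > 1`.** For a Haar measure
`ν` on `𝔸_Kˣ`, a unitary `η`, `Φ ∈ 𝒮(𝔸_Kⁿ)`, `re s > 1` and every `g`: each twisted Tate-type
integral `∫ Φ(a ξ g) |a|^{ns} η(a) dν(a)` converges absolutely, and the sum over the lines
`ξ ∈ ℙ^{n-1}(K)` of the absolute integrals converges — "absolutely convergent for `Re(s) > 1`"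
(Cogdell (2003), §2.3, p. 210; Jacquet–Shalika (1981), §4). Since `|η| = 1` the majorants are those
of the untwisted series (`norm_eisensteinKernelTwisted`) and `summable_mirabolicEisenstein_holds`
(`MirabolicEisensteinConvergence`) applies; the kernel is measurable because `η` is continuous on the
Borel space `𝔸_Kˣ` (`borelSpace_ideleGroup`).
[cite: CogdellAnalyticTheory2004, §2.3, p. 210] [cite: JacquetShalikaAJM1981, §4] -/
theorem integrable_and_summable_mirabolicEisensteinTwisted (ν : Measure (ideleGroup K)) [ν.IsHaarMeasure]
    {η : HeckeCharacter K} (hη : η.IsUnitary) {Φ : (Fin n → AdeleRing (𝓞 K) K) → ℂ}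
    (hΦ : Φ ∈ adelicSchwartzBruhat K n) {s : ℂ} (hs : 1 < s.re) (g : GL (Fin n) (AdeleRing (𝓞 K) K)) :
    (∀ p : Projectivization K (Fin n → K),
      Integrable (eisensteinKernelTwisted K η Φ s
        (ratVec K p.rep ᵥ* (g : Matrix (Fin n) (Fin n) (AdeleRing (𝓞 K) K)))) ν) ∧
    Summable fun p : Projectivization K (Fin n → K) =>
      ∫ a, ‖eisensteinKernelTwisted K η Φ s
        (ratVec K p.rep ᵥ* (g : Matrix (Fin n) (Fin n) (AdeleRing (𝓞 K) K))) a‖ ∂ν := by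
  haveI := borelSpace_ideleGroup K
  obtain ⟨hint, hsum⟩ := summable_mirabolicEisenstein_holds K ν Φ hΦ s hs g
  have hηm : Measurable fun a : ideleGroup K => ((η a : ℂˣ) : ℂ) :=
    (Units.continuous_val.comp (map_continuous η)).measurable
  refine ⟨fun p => ?_, ?_⟩
  · refine ⟨(hint p).aestronglyMeasurable.mul hηm.aestronglyMeasurable, ?_⟩
    refine (hint p).hasFiniteIntegral.congr' (Filter.Eventually.of_forall fun a => ?_)
    exact (norm_eisensteinKernelTwisted hη Φ s _ a).symm
  · refine hsum.congr fun p => integral_congr_ae (Filter.Eventually.of_forall fun a => ?_)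
    exact (norm_eisensteinKernelTwisted hη Φ s _ a).symm

/-- Under the same hypotheses the series of twisted Tate-type integrals defining `E(g, Φ; s, η)` is
(absolutely) summable, so that `mirabolicEisensteinTwisted` is a genuine sum on `re s > 1`
(`‖∫ f‖ ≤ ∫ ‖f‖`). [folklore] -/
theorem summable_tateVectorIntegralTwisted (ν : Measure (ideleGroup K)) [ν.IsHaarMeasure]
    {η : HeckeCharacter K} (hη : η.IsUnitary) {Φ : (Fin n → AdeleRing (𝓞 K) K) → ℂ}
    (hΦ : Φ ∈ adelicSchwartzBruhat K n) {s : ℂ} (hs : 1 < s.re) (g : GL (Fin n) (AdeleRing (𝓞 K) K)) :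
    Summable fun p : Projectivization K (Fin n → K) =>
      tateVectorIntegralTwisted K ν η Φ s
        (ratVec K p.rep ᵥ* (g : Matrix (Fin n) (Fin n) (AdeleRing (𝓞 K) K))) := by
  obtain ⟨-, hsum⟩ := integrable_and_summable_mirabolicEisensteinTwisted ν hη hΦ hs g
  refine Summable.of_norm_bounded hsum fun p => ?_
  exact norm_integral_le_integral_norm _

/-- **Domination by the untwisted series of `|Φ|` at the real point**: for unitary `η`, `re s > 1`,
`Φ ∈ 𝒮(𝔸_Kⁿ)` and a Haar measure `ν`,
`|E(g, Φ; s, η)| ≤ |det g|^{re s} ∑_ξ ∫ |Φ(a ξ g)| |a|^{n re s} dν(a)` — the bound by which every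
majorant of the untwisted theory (moderate growth, holomorphy in `s`) transfers to the twisted series.
[folklore] -/
theorem norm_mirabolicEisensteinTwisted_le (ν : Measure (ideleGroup K)) [ν.IsHaarMeasure]
    {η : HeckeCharacter K} (hη : η.IsUnitary) {Φ : (Fin n → AdeleRing (𝓞 K) K) → ℂ}
    (hΦ : Φ ∈ adelicSchwartzBruhat K n) {s : ℂ} (hs : 1 < s.re) (g : GL (Fin n) (AdeleRing (𝓞 K) K)) :
    ‖mirabolicEisensteinTwisted K ν η Φ s g‖ ≤
      (IdeleClassGroup.ideleNorm K (Matrix.GeneralLinearGroup.det g) : ℝ) ^ s.re *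
        ∑' p : Projectivization K (Fin n → K),
          ∫ a, ‖eisensteinKernel K Φ s
            (ratVec K p.rep ᵥ* (g : Matrix (Fin n) (Fin n) (AdeleRing (𝓞 K) K))) a‖ ∂ν := by
  obtain ⟨-, hsum⟩ := integrable_and_summable_mirabolicEisensteinTwisted ν hη hΦ hs g
  unfold mirabolicEisensteinTwisted
  rw [norm_mul, Complex.norm_cpow_eq_rpow_re_of_pos
    (NNReal.coe_pos.2 (pos_iff_ne_zero.2 (ideleNorm_ne_zero _)))]
  refine mul_le_mul_of_nonneg_left ?_ (Real.rpow_nonneg (NNReal.coe_nonneg _) _)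
  have hsum' : Summable fun p : Projectivization K (Fin n → K) =>
      ∫ a, ‖eisensteinKernel K Φ s (ratVec K p.rep ᵥ* (g : Matrix (Fin n) (Fin n) (AdeleRing (𝓞 K) K))) a‖ ∂ν := by
    refine hsum.congr fun p => integral_congr_ae (Filter.Eventually.of_forall fun a => ?_)
    exact norm_eisensteinKernelTwisted hη Φ s _ a
  refine (norm_tsum_le_tsum_norm ?_).trans ?_
  · refine Summable.of_nonneg_of_le (fun p => norm_nonneg _) (fun p => norm_integral_le_integral_norm _) hsum
  · refine Summable.tsum_le_tsum (fun p => ?_) ?_ hsum'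
    · unfold tateVectorIntegralTwisted
      refine (norm_integral_le_integral_norm _).trans (le_of_eq ?_)
      exact integral_congr_ae (Filter.Eventually.of_forall fun a => norm_eisensteinKernelTwisted hη Φ s _ a)
    · exact Summable.of_nonneg_of_le (fun p => norm_nonneg _) (fun p => norm_integral_le_integral_norm _) hsum

end Eisenstein

end Literature.NumberTheory.Automorphic
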